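import Summits.CriticalPhenomena.PercolationContinuityZ3.Theorems.PercNearOneGluingNoHeavyLowerTailKnQuestion8PocketNonPivotal
import HarnessLib

/-!
# KN Question 8 at three relays — the o-non-pivotal source, II: (club+) and (∗a)

Support file (`--supports stmt-CriticalPhenomena-4575`, closed crux), prover `prim-cplus-coupling` (gen 19).  No definitions, no named
facts, no sorries; standard axioms.  Part II of `…KnQuestion8PocketNonPivotal.lean` (the row (Ξ′) and EXCH-X′); memo
`prim-cplus-coupling/A5-COUPLING-gen19.md`, prim-lf-2 memo `PXI-gen19.md` §6.2–6.3/§9 (where both results are census-true conjectures).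

Setting (KN Question 8 pocket): observer `o`, relays `x, y`, designated relay `z`; `P = {o↮x} ∩ {o↮y} ∩ {o↮z}`,
`E1 = {x↮y} ∩ {x↮z}`, `E2 = {y↮x} ∩ {y↮z}`, `F = {x↔y} ∩ {x↮z}`, `X = {x,y,z pairwise separated}`, `A′ = {x ↔ y avoiding the pairs at o}`,
`W3ⁿ = {x↔o} ∩ A′ ∩ {x↮z}`, `W3ᵖ = {x↔o} ∩ {x↔y} ∩ A′ᶜ ∩ {x↮z}`, `d = μ({x↔o} ∩ F) = μ(W3ⁿ) + μ(W3ᵖ)`; masses `a = μ({x↔o}∩E1)`,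
`m_E1 = μ(P∩E1)`, `b = μ({y↔o}∩E2)`, `c₂ = μ(P∩E2)`, `m_F = μ(P∩F)`, `pX = μ(P∩X)`; O:P odds `r_x = a/m_E1`, `r_y = b/c₂`, `r_xy = d/m_F`.
* `PocketCert.pocket_clubPlus_mul` — **(club+)**: `μ(W3ⁿ)/m_F − μ(W3ᵖ)/m_E1 ≥ r_x + r_y` (product form; sharp by prim-lf-2's census):
  EXCH-X′ + prim-lf-2's `pocket_step1` for `(x,y)` and `(y,x)` + the mediant inequality;
* `PocketCert.pocket_starA_mul` — **(∗a)**: for every monotone `G ≥ 0`, `m_D · ∫_{W3ⁿ} G(C_x) ≥ κ_F · ∫_{P∩F} G(C_x)` with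
  `κ_F = (r_x + r_y)·m_E1 + r_xy·m_F`, `m_D = m_E1 + m_F` (product form): the row (Ξ′) + `pocket_exchX` + `pocket_step1` + the identity
  `(d+θ)·m_D·pX − (θ·m_E1 + d·pX)·(pX + m_F) = pX₁·(d·pX − θ·m_F)`, `θ = μ({x↔o}∩X) + μ({y↔o}∩X)`.
So the o-non-pivotal F-part of prim-lf-2's pair-functional pocket covariance comparison PCOV^ξ is a theorem; the o-pivotal/E-part is what
remains (memo A5-COUPLING-gen19 §3).
[cite: VandenbergHaggstromKahn2005, Thm. 2.1 (p. 9), §2.1 Lemma 2.4 (p. 10)] [cite: KozmaNitzan2024, Questions 8–9 (§5.5 p. 36)]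
-/

namespace Summit.CriticalPhenomena.PercolationContinuityZ3.Theorems

open MeasureTheory Set Literature.Probability.LatticeModels Literature.Probability.Percolation
open scoped Classical
open KNPreFKG BHK2006

noncomputable section

namespace PocketCert

variable {V : Type*} [Fintype V]

omit [Fintype V] in
/-- The KN Question 8 pocket family: the vertex sets avoiding `x`, `y`, `z`; `{C_o ∈ 𝒟₀} = {o↮x} ∩ {o↮y} ∩ {o↮z}`. [folklore] -/
theorem pocketQ8_eq (o x y z : V) :
    {ω : BondConfig V | openCluster ω o ∈ {W : Set V | x ∉ W ∧ y ∉ W ∧ z ∉ W}} =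
      {ω : BondConfig V | ¬ (openGraph ω).Reachable o x} ∩ {ω | ¬ (openGraph ω).Reachable o y} ∩
        {ω | ¬ (openGraph ω).Reachable o z} := by
  ext ω
  simp only [mem_setOf_eq, mem_inter_iff, openCluster]
  tauto

omit [Fintype V] in
/-- The KN Question 8 pocket family is down-closed. [folklore] -/
theorem pocketQ8_isLowerSet (x y z : V) : IsLowerSet {W : Set V | x ∉ W ∧ y ∉ W ∧ z ∉ W} := by
  intro W W' hle hW
  exact ⟨fun h => hW.1 (hle h), fun h => hW.2.1 (hle h), fun h => hW.2.2 (hle h)⟩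

/-- **(club+) — prim-lf-2's sharp scalar (PXI-gen19 §6.3), product form.**  KN Question 8 pocket `P = {o↮x} ∩ {o↮y} ∩ {o↮z}`,
`E1 = {x↮y} ∩ {x↮z}`, `E2 = {y↮x} ∩ {y↮z}`, `F = {x↔y} ∩ {x↮z}`, `X = {x,y,z pairwise separated}`, `A′ = {x↔y avoiding the pairs at o}`;
masses `a = μ({x↔o}∩E1)`, `m_E1 = μ(P∩E1)`, `b = μ({y↔o}∩E2)`, `c₂ = μ(P∩E2)`, `m_F = μ(P∩F)`, `pX = μ(P∩X)`,
`W3ⁿ = μ({x↔o} ∩ A′ ∩ {x↮z})`, `W3ᵖ = μ({x↔o} ∩ {x↔y} ∩ A′ᶜ ∩ {x↮z})`: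
`(a·m_F·c₂ + b·m_E1·m_F + W3ᵖ·m_F·c₂) · pX ≤ W3ⁿ·m_E1·c₂ · pX`, i.e. (for `pX, m_F, m_E1, c₂ > 0`)
`W3ⁿ/m_F − W3ᵖ/m_E1 ≥ a/m_E1 + b/c₂ = r_x + r_y`.  Proof: `pocket_exchX_avoid` + `pocket_step1` for `(x,y)` and `(y,x)` + mediant.
[cite: VandenbergHaggstromKahn2005, Thm. 2.1 (p. 9), §2.1 Lemma 2.4 (p. 10)] [cite: KozmaNitzan2024, Questions 8–9 (§5.5 p. 36)] -/
theorem pocket_clubPlus_mul (w : Sym2 V → unitInterval) (o x y z : V) :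
    ((prodBernoulli w).real (openConn x o ∩ ({ω | ¬ (openGraph ω).Reachable x y} ∩ {ω | ¬ (openGraph ω).Reachable x z})) *
          (prodBernoulli w).real (({ω : BondConfig V | ¬ (openGraph ω).Reachable o x} ∩ {ω | ¬ (openGraph ω).Reachable o y} ∩
            {ω | ¬ (openGraph ω).Reachable o z}) ∩ (openConn x y ∩ {ω | ¬ (openGraph ω).Reachable x z})) *
          (prodBernoulli w).real (({ω : BondConfig V | ¬ (openGraph ω).Reachable o x} ∩ {ω | ¬ (openGraph ω).Reachable o y} ∩
            {ω | ¬ (openGraph ω).Reachable o z}) ∩ ({ω | ¬ (openGraph ω).Reachable y x} ∩ {ω | ¬ (openGraph ω).Reachable y z})) +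
        (prodBernoulli w).real (openConn y o ∩ ({ω | ¬ (openGraph ω).Reachable y x} ∩ {ω | ¬ (openGraph ω).Reachable y z})) *
          (prodBernoulli w).real (({ω : BondConfig V | ¬ (openGraph ω).Reachable o x} ∩ {ω | ¬ (openGraph ω).Reachable o y} ∩
            {ω | ¬ (openGraph ω).Reachable o z}) ∩ ({ω | ¬ (openGraph ω).Reachable x y} ∩ {ω | ¬ (openGraph ω).Reachable x z})) *
          (prodBernoulli w).real (({ω : BondConfig V | ¬ (openGraph ω).Reachable o x} ∩ {ω | ¬ (openGraph ω).Reachable o y} ∩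
            {ω | ¬ (openGraph ω).Reachable o z}) ∩ (openConn x y ∩ {ω | ¬ (openGraph ω).Reachable x z})) +
        (prodBernoulli w).real (openConn x o ∩ openConn x y ∩ {ω | ¬ (openGraph (ω ∩ {e : Sym2 V | o ∉ e})).Reachable x y} ∩
            {ω | ¬ (openGraph ω).Reachable x z}) *
          (prodBernoulli w).real (({ω : BondConfig V | ¬ (openGraph ω).Reachable o x} ∩ {ω | ¬ (openGraph ω).Reachable o y} ∩
            {ω | ¬ (openGraph ω).Reachable o z}) ∩ (openConn x y ∩ {ω | ¬ (openGraph ω).Reachable x z})) *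
          (prodBernoulli w).real (({ω : BondConfig V | ¬ (openGraph ω).Reachable o x} ∩ {ω | ¬ (openGraph ω).Reachable o y} ∩
            {ω | ¬ (openGraph ω).Reachable o z}) ∩ ({ω | ¬ (openGraph ω).Reachable y x} ∩ {ω | ¬ (openGraph ω).Reachable y z}))) *
      (prodBernoulli w).real (({ω : BondConfig V | ¬ (openGraph ω).Reachable o x} ∩ {ω | ¬ (openGraph ω).Reachable o y} ∩
            {ω | ¬ (openGraph ω).Reachable o z}) ∩ ({ω | ¬ (openGraph ω).Reachable x y} ∩ {ω | ¬ (openGraph ω).Reachable x z} ∩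
          {ω | ¬ (openGraph ω).Reachable y z})) ≤
    (prodBernoulli w).real (openConn x o ∩ {ω | (openGraph (ω ∩ {e : Sym2 V | o ∉ e})).Reachable x y} ∩
          {ω | ¬ (openGraph ω).Reachable x z}) *
        (prodBernoulli w).real (({ω : BondConfig V | ¬ (openGraph ω).Reachable o x} ∩ {ω | ¬ (openGraph ω).Reachable o y} ∩
            {ω | ¬ (openGraph ω).Reachable o z}) ∩ ({ω | ¬ (openGraph ω).Reachable x y} ∩ {ω | ¬ (openGraph ω).Reachable x z})) *
        (prodBernoulli w).real (({ω : BondConfig V | ¬ (openGraph ω).Reachable o x} ∩ {ω | ¬ (openGraph ω).Reachable o y} ∩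
            {ω | ¬ (openGraph ω).Reachable o z}) ∩ ({ω | ¬ (openGraph ω).Reachable y x} ∩ {ω | ¬ (openGraph ω).Reachable y z})) *
      (prodBernoulli w).real (({ω : BondConfig V | ¬ (openGraph ω).Reachable o x} ∩ {ω | ¬ (openGraph ω).Reachable o y} ∩
            {ω | ¬ (openGraph ω).Reachable o z}) ∩ ({ω | ¬ (openGraph ω).Reachable x y} ∩ {ω | ¬ (openGraph ω).Reachable x z} ∩
          {ω | ¬ (openGraph ω).Reachable y z})) := by
  classical
  set μ := prodBernoulli w with hμ
  have hmeas : ∀ S' : Set (BondConfig V), MeasurableSet S' := fun _ => MeasurableSet.of_discrete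
  have hn := fun (S' : Set (BondConfig V)) => (measureReal_nonneg : 0 ≤ μ.real S')
  set 𝒟 : Set (Set V) := {W : Set V | x ∉ W ∧ y ∉ W ∧ z ∉ W} with h𝒟def
  have h𝒟 : IsLowerSet 𝒟 := pocketQ8_isLowerSet x y z
  have hx : ∀ W ∈ 𝒟, x ∉ W := fun W hW => hW.1
  have hy : ∀ W ∈ 𝒟, y ∉ W := fun W hW => hW.2.1
  have hz : ∀ W ∈ 𝒟, z ∉ W := fun W hW => hW.2.2
  have hPD := pocketQ8_eq o x y z
  set P : Set (BondConfig V) := {ω : BondConfig V | ¬ (openGraph ω).Reachable o x} ∩ {ω | ¬ (openGraph ω).Reachable o y} ∩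
      {ω | ¬ (openGraph ω).Reachable o z} with hP
  set E1 : Set (BondConfig V) := {ω | ¬ (openGraph ω).Reachable x y} ∩ {ω | ¬ (openGraph ω).Reachable x z} with hE1
  set E2 : Set (BondConfig V) := {ω | ¬ (openGraph ω).Reachable y x} ∩ {ω | ¬ (openGraph ω).Reachable y z} with hE2
  set X : Set (BondConfig V) := {ω | ¬ (openGraph ω).Reachable x y} ∩ {ω | ¬ (openGraph ω).Reachable x z} ∩
      {ω | ¬ (openGraph ω).Reachable y z} with hX
  set X1 : Set (BondConfig V) := {ω | ¬ (openGraph ω).Reachable x y} ∩ {ω | ¬ (openGraph ω).Reachable x z} ∩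
      openConn y z with hX1
  set X' : Set (BondConfig V) := {ω | ¬ (openGraph ω).Reachable y x} ∩ {ω | ¬ (openGraph ω).Reachable y z} ∩
      {ω | ¬ (openGraph ω).Reachable x z} with hX'
  set X2 : Set (BondConfig V) := {ω | ¬ (openGraph ω).Reachable y x} ∩ {ω | ¬ (openGraph ω).Reachable y z} ∩
      openConn x z with hX2
  set Fv : Set (BondConfig V) := openConn x y ∩ {ω | ¬ (openGraph ω).Reachable x z} with hFv
  set Wn : Set (BondConfig V) := openConn x o ∩ {ω | (openGraph (ω ∩ {e : Sym2 V | o ∉ e})).Reachable x y} ∩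
      {ω | ¬ (openGraph ω).Reachable x z} with hWn
  set Wp : Set (BondConfig V) := openConn x o ∩ openConn x y ∩ {ω | ¬ (openGraph (ω ∩ {e : Sym2 V | o ∉ e})).Reachable x y} ∩
      {ω | ¬ (openGraph ω).Reachable x z} with hWp
  -- the exchange inequalities
  have hexch := pocket_exchX_avoid w o x y z
  have hs1 := pocket_step1 w o x y z 𝒟 h𝒟 hy hz
  have hs2 := pocket_step1 w o y x z 𝒟 h𝒟 hx hz
  rw [hPD] at hs1 hs2
  have hXX : X' = X := by
    ext ω
    simp only [hX, hX', mem_inter_iff, mem_setOf_eq]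
    constructor
    · rintro ⟨⟨hyx, hyz⟩, hxz⟩; exact ⟨⟨fun h => hyx h.symm, hxz⟩, hyz⟩
    · rintro ⟨⟨hxy, hxz⟩, hyz⟩; exact ⟨⟨fun h => hxy h.symm, hyz⟩, hxz⟩
  change (μ.real Wp + μ.real (openConn x o ∩ X) + μ.real (openConn y o ∩ X)) * μ.real (P ∩ Fv) ≤
    μ.real Wn * μ.real (P ∩ X) at hexch
  change μ.real (openConn x o ∩ X1) * μ.real (P ∩ X) ≤ μ.real (P ∩ X1) * μ.real (openConn x o ∩ X) at hs1
  change μ.real (openConn y o ∩ X2) * μ.real (P ∩ X') ≤ μ.real (P ∩ X2) * μ.real (openConn y o ∩ X') at hs2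
  rw [hXX] at hs2
  -- splitting E1 = X ⊔ X1 and E2 = X ⊔ X2
  have split1 : ∀ B : Set (BondConfig V), μ.real (B ∩ E1) = μ.real (B ∩ X) + μ.real (B ∩ X1) := by
    intro B
    have h := measureReal_inter_add_sdiff₀ (μ := μ) (s := B ∩ E1) (t := openConn y z) (hmeas _).nullMeasurableSet
    have e1 : B ∩ E1 ∩ openConn y z = B ∩ X1 := by
      ext ω; simp only [hE1, hX1, mem_inter_iff]; tauto
    have e2 : (B ∩ E1) \ openConn y z = B ∩ X := by
      ext ω; simp only [hE1, hX, mem_inter_iff, mem_sdiff, openConn, mem_setOf_eq]; tauto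
    rw [e1, e2] at h; linarith
  have split2 : ∀ B : Set (BondConfig V), μ.real (B ∩ E2) = μ.real (B ∩ X) + μ.real (B ∩ X2) := by
    intro B
    have h := measureReal_inter_add_sdiff₀ (μ := μ) (s := B ∩ E2) (t := openConn x z) (hmeas _).nullMeasurableSet
    have e1 : B ∩ E2 ∩ openConn x z = B ∩ X2 := by
      ext ω; simp only [hE2, hX2, mem_inter_iff]; tauto
    have e2 : (B ∩ E2) \ openConn x z = B ∩ X := by
      rw [← hXX]; ext ω; simp only [hE2, hX', mem_inter_iff, mem_sdiff, openConn, mem_setOf_eq]; tauto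
    rw [e1, e2] at h; linarith
  change (μ.real (openConn x o ∩ E1) * μ.real (P ∩ Fv) * μ.real (P ∩ E2) +
      μ.real (openConn y o ∩ E2) * μ.real (P ∩ E1) * μ.real (P ∩ Fv) + μ.real Wp * μ.real (P ∩ Fv) * μ.real (P ∩ E2)) *
      μ.real (P ∩ X) ≤ μ.real Wn * μ.real (P ∩ E1) * μ.real (P ∩ E2) * μ.real (P ∩ X)
  rw [split1 (openConn x o), split1 P, split2 (openConn y o), split2 P]
  set oX := μ.real (openConn x o ∩ X)
  set oX1 := μ.real (openConn x o ∩ X1)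
  set oyX := μ.real (openConn y o ∩ X)
  set oyX2 := μ.real (openConn y o ∩ X2)
  set pX := μ.real (P ∩ X)
  set pX1 := μ.real (P ∩ X1)
  set pX2 := μ.real (P ∩ X2)
  set pF := μ.real (P ∩ Fv)
  set wn := μ.real Wn
  set wp := μ.real Wp
  have i1 : (oX + oX1) * pX ≤ oX * (pX + pX1) := by nlinarith [hs1, hn (openConn x o ∩ X), hn (P ∩ X)]
  have i2 : (oyX + oyX2) * pX ≤ oyX * (pX + pX2) := by nlinarith [hs2, hn (openConn y o ∩ X), hn (P ∩ X)]
  have j1 : (oX + oX1) * pX * (pF * (pX + pX2)) ≤ oX * (pX + pX1) * (pF * (pX + pX2)) :=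
    mul_le_mul_of_nonneg_right i1 (mul_nonneg (hn _) (add_nonneg (hn _) (hn _)))
  have j2 : (oyX + oyX2) * pX * (pF * (pX + pX1)) ≤ oyX * (pX + pX2) * (pF * (pX + pX1)) :=
    mul_le_mul_of_nonneg_right i2 (mul_nonneg (hn _) (add_nonneg (hn _) (hn _)))
  have j3 : (wp + oX + oyX) * pF * ((pX + pX1) * (pX + pX2)) ≤ wn * pX * ((pX + pX1) * (pX + pX2)) :=
    mul_le_mul_of_nonneg_right hexch (mul_nonneg (add_nonneg (hn _) (hn _)) (add_nonneg (hn _) (hn _)))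
  have j4 : wp * pF * (pX + pX2) * pX ≤ wp * pF * (pX + pX2) * (pX + pX1) :=
    mul_le_mul_of_nonneg_left (le_add_of_nonneg_right (hn _)) (mul_nonneg (mul_nonneg (hn _) (hn _)) (add_nonneg (hn _) (hn _)))
  nlinarith [j1, j2, j3, j4]

/-- **(∗a) — the o-non-pivotal domination (prim-lf-2 PXI-gen19 §6.2), product form.**  With the events and masses of
`pocket_clubPlus_mul`, `d = μ({x↔o} ∩ {x↔y} ∩ {x↮z})` and `m_D = m_E1 + m_F`: for every monotone `G ≥ 0` on vertex sets,
`(a·c₂ + b·m_E1 + d·c₂) · pX · ∫_{P∩F} G(C_x) ≤ (m_E1 + m_F)·c₂ · pX · ∫_{W3ⁿ} G(C_x)`, i.e. (for `pX, c₂ > 0`)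
`m_D · ∫_{W3ⁿ} G ≥ κ_F · ∫_{P∩F} G` with `κ_F = a + d + b·m_E1/c₂ = (r_x + r_y)·m_E1 + r_xy·m_F` — the law of `C_x` on the o-non-pivotal
part of `{o, y ∈ C_x, z ∉ C_x}` dominates `κ_F/m_D` times the pocket law on `{x↔y, x↮z}`.  Proof: `pocket_nonpivotal_row` + `pocket_exchX`
+ `pocket_step1` for `(x,y)` and `(y,x)` + the identity `(d+θ)·m_D·pX − (θ·m_E1 + d·pX)·(pX + m_F) = pX₁·(d·pX − θ·m_F)`, `θ = oX + o′X`.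
[cite: VandenbergHaggstromKahn2005, Thm. 2.1 (p. 9), §2.1 Lemma 2.4 (p. 10)] [cite: KozmaNitzan2024, Questions 8–9 (§5.5 p. 36)] -/
theorem pocket_starA_mul (w : Sym2 V → unitInterval) (o x y z : V) (G : Set V → ℝ)
    (hG : ∀ S T : Set V, S ⊆ T → G S ≤ G T) (hG0 : ∀ S : Set V, 0 ≤ G S) :
    ((prodBernoulli w).real (openConn x o ∩ ({ω | ¬ (openGraph ω).Reachable x y} ∩ {ω | ¬ (openGraph ω).Reachable x z})) *
          (prodBernoulli w).real (({ω : BondConfig V | ¬ (openGraph ω).Reachable o x} ∩ {ω | ¬ (openGraph ω).Reachable o y} ∩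
            {ω | ¬ (openGraph ω).Reachable o z}) ∩ ({ω | ¬ (openGraph ω).Reachable y x} ∩ {ω | ¬ (openGraph ω).Reachable y z})) +
        (prodBernoulli w).real (openConn y o ∩ ({ω | ¬ (openGraph ω).Reachable y x} ∩ {ω | ¬ (openGraph ω).Reachable y z})) *
          (prodBernoulli w).real (({ω : BondConfig V | ¬ (openGraph ω).Reachable o x} ∩ {ω | ¬ (openGraph ω).Reachable o y} ∩
            {ω | ¬ (openGraph ω).Reachable o z}) ∩ ({ω | ¬ (openGraph ω).Reachable x y} ∩ {ω | ¬ (openGraph ω).Reachable x z})) +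
        (prodBernoulli w).real (openConn x o ∩ openConn x y ∩ {ω | ¬ (openGraph ω).Reachable x z}) *
          (prodBernoulli w).real (({ω : BondConfig V | ¬ (openGraph ω).Reachable o x} ∩ {ω | ¬ (openGraph ω).Reachable o y} ∩
            {ω | ¬ (openGraph ω).Reachable o z}) ∩ ({ω | ¬ (openGraph ω).Reachable y x} ∩ {ω | ¬ (openGraph ω).Reachable y z}))) *
        (prodBernoulli w).real (({ω : BondConfig V | ¬ (openGraph ω).Reachable o x} ∩ {ω | ¬ (openGraph ω).Reachable o y} ∩
            {ω | ¬ (openGraph ω).Reachable o z}) ∩ ({ω | ¬ (openGraph ω).Reachable x y} ∩ {ω | ¬ (openGraph ω).Reachable x z} ∩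
          {ω | ¬ (openGraph ω).Reachable y z})) *
      ∫ ω in ({ω : BondConfig V | ¬ (openGraph ω).Reachable o x} ∩ {ω | ¬ (openGraph ω).Reachable o y} ∩
            {ω | ¬ (openGraph ω).Reachable o z}) ∩ (openConn x y ∩ {ω | ¬ (openGraph ω).Reachable x z}),
          G (openCluster ω x) ∂(prodBernoulli w) ≤
    ((prodBernoulli w).real (({ω : BondConfig V | ¬ (openGraph ω).Reachable o x} ∩ {ω | ¬ (openGraph ω).Reachable o y} ∩
            {ω | ¬ (openGraph ω).Reachable o z}) ∩ ({ω | ¬ (openGraph ω).Reachable x y} ∩ {ω | ¬ (openGraph ω).Reachable x z})) +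
        (prodBernoulli w).real (({ω : BondConfig V | ¬ (openGraph ω).Reachable o x} ∩ {ω | ¬ (openGraph ω).Reachable o y} ∩
            {ω | ¬ (openGraph ω).Reachable o z}) ∩ (openConn x y ∩ {ω | ¬ (openGraph ω).Reachable x z}))) *
        (prodBernoulli w).real (({ω : BondConfig V | ¬ (openGraph ω).Reachable o x} ∩ {ω | ¬ (openGraph ω).Reachable o y} ∩
            {ω | ¬ (openGraph ω).Reachable o z}) ∩ ({ω | ¬ (openGraph ω).Reachable y x} ∩ {ω | ¬ (openGraph ω).Reachable y z})) *
        (prodBernoulli w).real (({ω : BondConfig V | ¬ (openGraph ω).Reachable o x} ∩ {ω | ¬ (openGraph ω).Reachable o y} ∩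
            {ω | ¬ (openGraph ω).Reachable o z}) ∩ ({ω | ¬ (openGraph ω).Reachable x y} ∩ {ω | ¬ (openGraph ω).Reachable x z} ∩
          {ω | ¬ (openGraph ω).Reachable y z})) *
      ∫ ω in openConn x o ∩ {ω | (openGraph (ω ∩ {e : Sym2 V | o ∉ e})).Reachable x y} ∩ {ω | ¬ (openGraph ω).Reachable x z},
          G (openCluster ω x) ∂(prodBernoulli w) := by
  classical
  set μ := prodBernoulli w with hμ
  have hmeas : ∀ S' : Set (BondConfig V), MeasurableSet S' := fun _ => MeasurableSet.of_discrete
  have hn := fun (S' : Set (BondConfig V)) => (measureReal_nonneg : 0 ≤ μ.real S')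
  set 𝒟 : Set (Set V) := {W : Set V | x ∉ W ∧ y ∉ W ∧ z ∉ W} with h𝒟def
  have h𝒟 : IsLowerSet 𝒟 := pocketQ8_isLowerSet x y z
  have hx : ∀ W ∈ 𝒟, x ∉ W := fun W hW => hW.1
  have hy : ∀ W ∈ 𝒟, y ∉ W := fun W hW => hW.2.1
  have hz : ∀ W ∈ 𝒟, z ∉ W := fun W hW => hW.2.2
  have hPD := pocketQ8_eq o x y z
  set P : Set (BondConfig V) := {ω : BondConfig V | ¬ (openGraph ω).Reachable o x} ∩ {ω | ¬ (openGraph ω).Reachable o y} ∩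
      {ω | ¬ (openGraph ω).Reachable o z} with hP
  set E1 : Set (BondConfig V) := {ω | ¬ (openGraph ω).Reachable x y} ∩ {ω | ¬ (openGraph ω).Reachable x z} with hE1
  set E2 : Set (BondConfig V) := {ω | ¬ (openGraph ω).Reachable y x} ∩ {ω | ¬ (openGraph ω).Reachable y z} with hE2
  set X : Set (BondConfig V) := {ω | ¬ (openGraph ω).Reachable x y} ∩ {ω | ¬ (openGraph ω).Reachable x z} ∩
      {ω | ¬ (openGraph ω).Reachable y z} with hX
  set X1 : Set (BondConfig V) := {ω | ¬ (openGraph ω).Reachable x y} ∩ {ω | ¬ (openGraph ω).Reachable x z} ∩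
      openConn y z with hX1
  set X' : Set (BondConfig V) := {ω | ¬ (openGraph ω).Reachable y x} ∩ {ω | ¬ (openGraph ω).Reachable y z} ∩
      {ω | ¬ (openGraph ω).Reachable x z} with hX'
  set X2 : Set (BondConfig V) := {ω | ¬ (openGraph ω).Reachable y x} ∩ {ω | ¬ (openGraph ω).Reachable y z} ∩
      openConn x z with hX2
  set Fv : Set (BondConfig V) := openConn x y ∩ {ω | ¬ (openGraph ω).Reachable x z} with hFv
  set Wn : Set (BondConfig V) := openConn x o ∩ {ω | (openGraph (ω ∩ {e : Sym2 V | o ∉ e})).Reachable x y} ∩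
      {ω | ¬ (openGraph ω).Reachable x z} with hWn
  set W3 : Set (BondConfig V) := openConn x o ∩ openConn x y ∩ {ω | ¬ (openGraph ω).Reachable x z} with hW3
  -- the four inequalities
  have hrow := pocket_nonpivotal_row w o x y z G hG hG0
  have hexch := pocket_exchX w o x y z 𝒟 h𝒟 hz
  have hs1 := pocket_step1 w o x y z 𝒟 h𝒟 hy hz
  have hs2 := pocket_step1 w o y x z 𝒟 h𝒟 hx hz
  rw [hPD] at hexch hs1 hs2
  have hXX : X' = X := by
    ext ω
    simp only [hX, hX', mem_inter_iff, mem_setOf_eq]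
    constructor
    · rintro ⟨⟨hyx, hyz⟩, hxz⟩; exact ⟨⟨fun h => hyx h.symm, hxz⟩, hyz⟩
    · rintro ⟨⟨hxy, hxz⟩, hyz⟩; exact ⟨⟨fun h => hxy h.symm, hyz⟩, hxz⟩
  change (μ.real W3 + μ.real (openConn x o ∩ X) + μ.real (openConn y o ∩ X)) * (∫ ω in P ∩ Fv, G (openCluster ω x) ∂μ) ≤
    (μ.real (P ∩ X) + μ.real (P ∩ Fv)) * ∫ ω in Wn, G (openCluster ω x) ∂μ at hrow
  change (μ.real (openConn x o ∩ X) + μ.real (openConn y o ∩ X)) * μ.real (P ∩ Fv) ≤ μ.real W3 * μ.real (P ∩ X) at hexch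
  change μ.real (openConn x o ∩ X1) * μ.real (P ∩ X) ≤ μ.real (P ∩ X1) * μ.real (openConn x o ∩ X) at hs1
  change μ.real (openConn y o ∩ X2) * μ.real (P ∩ X') ≤ μ.real (P ∩ X2) * μ.real (openConn y o ∩ X') at hs2
  rw [hXX] at hs2
  have split1 : ∀ B : Set (BondConfig V), μ.real (B ∩ E1) = μ.real (B ∩ X) + μ.real (B ∩ X1) := by
    intro B
    have h := measureReal_inter_add_sdiff₀ (μ := μ) (s := B ∩ E1) (t := openConn y z) (hmeas _).nullMeasurableSet
    have e1 : B ∩ E1 ∩ openConn y z = B ∩ X1 := by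
      ext ω; simp only [hE1, hX1, mem_inter_iff]; tauto
    have e2 : (B ∩ E1) \ openConn y z = B ∩ X := by
      ext ω; simp only [hE1, hX, mem_inter_iff, mem_sdiff, openConn, mem_setOf_eq]; tauto
    rw [e1, e2] at h; linarith
  have split2 : ∀ B : Set (BondConfig V), μ.real (B ∩ E2) = μ.real (B ∩ X) + μ.real (B ∩ X2) := by
    intro B
    have h := measureReal_inter_add_sdiff₀ (μ := μ) (s := B ∩ E2) (t := openConn x z) (hmeas _).nullMeasurableSet
    have e1 : B ∩ E2 ∩ openConn x z = B ∩ X2 := by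
      ext ω; simp only [hE2, hX2, mem_inter_iff]; tauto
    have e2 : (B ∩ E2) \ openConn x z = B ∩ X := by
      rw [← hXX]; ext ω; simp only [hE2, hX', mem_inter_iff, mem_sdiff, openConn, mem_setOf_eq]; tauto
    rw [e1, e2] at h; linarith
  change (μ.real (openConn x o ∩ E1) * μ.real (P ∩ E2) + μ.real (openConn y o ∩ E2) * μ.real (P ∩ E1) +
        μ.real W3 * μ.real (P ∩ E2)) * μ.real (P ∩ X) * (∫ ω in P ∩ Fv, G (openCluster ω x) ∂μ) ≤
      (μ.real (P ∩ E1) + μ.real (P ∩ Fv)) * μ.real (P ∩ E2) * μ.real (P ∩ X) * ∫ ω in Wn, G (openCluster ω x) ∂μ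
  rw [split1 (openConn x o), split1 P, split2 (openConn y o), split2 P]
  set oX := μ.real (openConn x o ∩ X)
  set oX1 := μ.real (openConn x o ∩ X1)
  set oyX := μ.real (openConn y o ∩ X)
  set oyX2 := μ.real (openConn y o ∩ X2)
  set pX := μ.real (P ∩ X)
  set pX1 := μ.real (P ∩ X1)
  set pX2 := μ.real (P ∩ X2)
  set pF := μ.real (P ∩ Fv)
  set wn := μ.real Wn
  set d := μ.real W3
  set IP := ∫ ω in P ∩ Fv, G (openCluster ω x) ∂μ
  set IW := ∫ ω in Wn, G (openCluster ω x) ∂μ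
  have hIP : 0 ≤ IP := setIntegral_nonneg (μ := μ) (hmeas _) fun ω _ => hG0 (openCluster ω x)
  have hIW : 0 ≤ IW := setIntegral_nonneg (μ := μ) (hmeas _) fun ω _ => hG0 (openCluster ω x)
  have i1 : (oX + oX1) * pX ≤ oX * (pX + pX1) := by nlinarith [hs1, hn (openConn x o ∩ X), hn (P ∩ X)]
  have i2 : (oyX + oyX2) * pX ≤ oyX * (pX + pX2) := by nlinarith [hs2, hn (openConn y o ∩ X), hn (P ∩ X)]
  -- (κ_F·pX)·c₂ ≤ c₂·(θ·m_E1 + d·pX)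
  have k1 : ((oX + oX1) * (pX + pX2) + (oyX + oyX2) * (pX + pX1) + d * (pX + pX2)) * pX ≤
      (pX + pX2) * ((oX + oyX) * (pX + pX1) + d * pX) := by
    have := mul_le_mul_of_nonneg_right i1 (add_nonneg (hn (P ∩ X)) (hn (P ∩ X2)))
    have := mul_le_mul_of_nonneg_right i2 (add_nonneg (hn (P ∩ X)) (hn (P ∩ X1)))
    nlinarith [hn (P ∩ X), hn (P ∩ X1), hn (P ∩ X2), hn W3]
  -- (θ·m_E1 + d·pX)·(pX + m_F) ≤ (d + θ)·m_D·pX  [difference = pX1·(d·pX − θ·pF) ≥ 0 by EXCH-X]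
  have k2 : ((oX + oyX) * (pX + pX1) + d * pX) * (pX + pF) ≤ (d + oX + oyX) * (pX + pX1 + pF) * pX := by
    have := mul_le_mul_of_nonneg_right hexch (hn (P ∩ X1))
    nlinarith [this]
  -- combine with the row: (d + θ)·IP ≤ (pX + pF)·IW
  have k3 : ((oX + oyX) * (pX + pX1) + d * pX) * (pX + pF) * IP ≤ (pX + pF) * (pX + pX1 + pF) * pX * IW := by
    have a1 := mul_le_mul_of_nonneg_right k2 hIP
    have a2 := mul_le_mul_of_nonneg_left hrow (mul_nonneg (add_nonneg (add_nonneg (hn (P ∩ X)) (hn (P ∩ X1))) (hn (P ∩ Fv))) (hn (P ∩ X)))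
    nlinarith [a1, a2]
  by_cases hpos : pX + pF = 0
  · have hpX : pX = 0 := le_antisymm (by nlinarith [hn (P ∩ X), hn (P ∩ Fv)]) (hn _)
    rw [hpX]; simp
  · have hpos' : 0 < pX + pF := lt_of_le_of_ne (add_nonneg (hn _) (hn _)) (Ne.symm hpos)
    have k4 : ((oX + oyX) * (pX + pX1) + d * pX) * IP ≤ (pX + pX1 + pF) * pX * IW := by
      have : ((oX + oyX) * (pX + pX1) + d * pX) * IP * (pX + pF) ≤ (pX + pX1 + pF) * pX * IW * (pX + pF) := by
        nlinarith [k3]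
      exact le_of_mul_le_mul_right this hpos'
    have k5 := mul_le_mul_of_nonneg_right k1 hIP
    have k6 := mul_le_mul_of_nonneg_left k4 (add_nonneg (hn (P ∩ X)) (hn (P ∩ X2)))
    nlinarith [k5, k6, hn (P ∩ X), hn (P ∩ X2)]

end PocketCert

end

end Summit.CriticalPhenomena.PercolationContinuityZ3.Theorems
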